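import Mathlib
import Summits.Ventures.PercRepro2.K2nRoutes
import Summits.Ventures.PercRepro2.TypedClassPendant

/-!
# The typed (PS) count is nonnegative on every `K_{2,n}` — termwise
(blind cell PercRepro2, night-3 g27, 2026-08-29; `proofs/NIGHT3-CERT.md` §36.10)

On `K_{2,n}` a colouring whose red cluster `R` of `s` contains `v` while the blue cluster `B` does
not has `B ⊆ R`: a leaf in `B` has its hub edge blue, so (no route being fully blue — `v ∉ B`) its
`v`-edge is red and, `v` being red-connected, the leaf is in `R` (`cluster_compl_subset_of_conn`).
Hence every term of the typed (PS) count `S_D = typedCountW wXOR` (the class «`v` in exactly one of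
`R`, `B`», `TypedClassPendant`) is a product of two increments of the same sign, and
`S_D(K_{2,n}; F, G) ≥ 0` for every `n` and all increasing `F, G` (`typedCountXOR_K2n_nonneg`) —
where the typed (PS1) count is `−3` already on `K_{2,5}` (`TypedCountNegative`).
Own work; standard axioms.
-/

namespace Summit.Ventures.PercRepro2

namespace K2n

open TypedDeletion

/-- Every vertex of `K_{2,n}` is a hub or a leaf. -/
lemma eq_zero_or_one_or_leaf {n : ℕ} (x : Fin (n + 2)) :
    x = 0 ∨ x = 1 ∨ ∃ ℓ : Fin n, x = leaf ℓ := by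
  rcases x with ⟨k, hk⟩
  rcases k with _ | _ | k
  · exact Or.inl rfl
  · exact Or.inr (Or.inl rfl)
  · refine Or.inr (Or.inr ⟨⟨k, by omega⟩, ?_⟩)
    simp [leaf]

/-- The complementary configuration. -/
def compl' {n : ℕ} (ω : Config (Fin n × Bool)) : Config (Fin n × Bool) := fun e => !ω e

/-- Evaluation of the complement. -/
@[simp] lemma compl'_apply {n : ℕ} (ω : Config (Fin n × Bool)) (e : Fin n × Bool) :
    compl' ω e = !ω e := rfl

/-- **The comparability lemma**: if `s ↔ v` in `ω` but not in the complementary configuration,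
the complementary cluster of `s` lies inside the cluster of `s` in `ω`. -/
theorem cluster_compl_subset_of_conn {n : ℕ} (ω : Config (Fin n × Bool))
    (hv : Conn (ends n) ω 0 1) (hv' : ¬ Conn (ends n) (compl' ω) 0 1) :
    cluster (ends n) (compl' ω) 0 ⊆ cluster (ends n) ω 0 := by
  intro x hx
  rcases eq_zero_or_one_or_leaf x with rfl | rfl | ⟨ℓ, rfl⟩
  · exact mem_cluster_self _ _ _
  · exact absurd hx hv'
  · rw [leaf_mem_cluster_iff] at hx
    rcases hx with hf | ⟨-, hc⟩
    · -- the hub edge is blue; the `v`-edge cannot be blue too (the route would join `s` to `v`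
      -- in the complement), so it is red
      have ht : (compl' ω) (ℓ, true) = false := by
        rcases Bool.eq_false_or_eq_true ((compl' ω) (ℓ, true)) with h | h
        · exact absurd ((conn_sv_iff (compl' ω)).2 ⟨ℓ, hf, h⟩) hv'
        · exact h
      have ht' : ω (ℓ, true) = true := by simpa using ht
      rw [leaf_mem_cluster_iff]
      exact Or.inr ⟨ht', hv⟩
    · exact absurd hc hv'

/-- `flipOn univ` is the complement. -/
lemma flipOn_univ_eq_compl' {n : ℕ} (ω : Config (Fin n × Bool)) :
    flipOn (Finset.univ : Finset (Fin n × Bool)) ω = compl' ω := by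
  funext e
  rw [flipOn_apply]
  simp

/-- Two increments of the same sign have a nonnegative product. -/
lemma dlt_nonneg_of_subset {n : ℕ} {F G : Set (Fin (n + 2)) → ℚ} (hF : Monotone F)
    (hG : Monotone G) {P Q : Set (Fin (n + 2))} (h : Q ⊆ P ∨ P ⊆ Q) : 0 ≤ dlt F G P Q := by
  unfold dlt
  rcases h with h | h
  · exact mul_nonneg (sub_nonneg.2 (hF h)) (sub_nonneg.2 (hG h))
  · exact mul_nonneg_of_nonpos_of_nonpos (sub_nonpos.2 (hF h)) (sub_nonpos.2 (hG h))

/-- **The typed (PS) count is nonnegative on every `K_{2,n}`, termwise.** -/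
theorem typedCountXOR_K2n_nonneg (n : ℕ) {F G : Set (Fin (n + 2)) → ℚ} (hF : Monotone F)
    (hG : Monotone G) :
    0 ≤ typedCountW (wXOR : Bool → Bool → ℚ) (ends n) 0 1 F G Finset.univ ∅ := by
  unfold typedCountW
  refine Finset.sum_nonneg fun ω _ => ?_
  split_ifs with hω
  · simp only [withC_empty, flipOn_univ_eq_compl']
    unfold wtW wXOR
    by_cases hr : (1 : Fin (n + 2)) ∈ cluster (ends n) ω 0 <;>
      by_cases hb : (1 : Fin (n + 2)) ∈ cluster (ends n) (compl' ω) 0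
    · simp [hr, hb]
    · rw [if_pos (by simp [hr, hb]), one_mul]
      refine dlt_nonneg_of_subset hF hG (Or.inl ?_)
      exact cluster_compl_subset_of_conn ω hr hb
    · rw [if_pos (by simp [hr, hb]), one_mul]
      refine dlt_nonneg_of_subset hF hG (Or.inr ?_)
      have h := cluster_compl_subset_of_conn (compl' ω) hb (by
        have : compl' (compl' ω) = ω := by funext e; simp
        rw [this]; exact hr)
      have hcc : compl' (compl' ω) = ω := by funext e; simp
      rw [hcc] at h
      exact h
    · simp [hr, hb]
  · exact le_rfl

end K2n

end Summit.Ventures.PercRepro2
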